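import Literature.IUT.HodgeTheaters.StableCurveTemperedDataOfSpecialFibreSec2OneCallFrame
import Literature.IUT.HodgeTheaters.StableCurveTemperedDataOfSpecialFibreSec2OneCallNV
import HarnessLib

/-!
# The LITERAL §2 one-call ([SemiAnbd] Thm 5.4 (i) binder in its own frame) is JOINTLY NON-VACUOUS — for EVERY frame,
# in particular the canonical Prop 5.2 (iv) frame `Π^tp_j ↠ Π^tp_j ⧸ π₁^temp(𝒢_j)` ([IUTchI] Prop. 2.4, Cor. 2.5, pp. 50–51)

S. Mochizuki, *Inter-universal Teichmüller theory I*, kurims manuscript (May 2020), §2, Prop. 2.4 (i)(ii)(iii) pp. 50–51,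
Cor. 2.5 p. 51 [cite: Mochizuki2012, Prop 2.4 pp.50-51] (D-0012 claim key; nothing of the series is asserted here);
S. Mochizuki, *Semi-graphs of anabelioids*, Publ. RIMS **42** (2006), Prop. 5.2 (iv) p. 64, Thm. 5.4 (i) p. 66, Ex. 3.10 p. 44
[cite: MochizukiSemiAnbd2006, Thm 5.4 (i) p.66].

PROOF-ONLY non-vacuity file (abc-iut cell, L5 [IUTchI] §2 lineage, abc-iut-L5-t11 gen 13, row «SEC2-NV-LITERAL-FRAME»
part (G); no definition, no instance, no notation, no new `Prop` fact).  The LITERAL one-call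
`StableCurveTemperedData.OfSpecialFibre.prop24_cor25_ofPiData_byName_noRF_literal` (abc-iut-L5-t11 gen 11, p485729)
concludes [IUTchI] Prop. 2.4 (i)(ii)(iii) ∧ Cor. 2.5 AS TYPED at the genuine 𝔛-datum from the origin records
`(T, P : PiData)`, a cusp, the six LAWS `hTF · hNN_i · hab · hadm · hI_j^lit · hA3ar_j`, identification / decomposition
DATA, and — new versus p467772 — DISPLAYED frame data `{PA j, α j, hαo, hαN}` (any open homomorphism `α_j` out of
`Π^tp_j := Π^temp_{X_K} ⧸ admKer_j` killing `N̄_j := N_j ⧸ admKer_j = π₁^temp(𝒢_j)`), with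
`hI_j^lit : ArithMaximalCompactStatementI (Dd j) (α j)`.  Here:

* `arithStatementI_oneVertexDecompositionData` — pure group theory: for the ONE-VERTEX decomposition data
  (`Π^temp_{𝔊,v} := ⊤`, no branch) [SemiAnbd] Thm 5.4 (i)'s conclusion-shape `ArithMaximalCompactStatementI` holds for
  EVERY augmentation (the only verticial subgroup is `⊤`; the two-verticial clause is vacuous) — DEGENERATE;
* `prop24_cor25_ofPiData_byName_literal_of_oneVertexFibres` — at ANY 𝔛-datum whose special-fibre tower has ONE-VERTEX
  fibres with `⊤` verticial (abc-iut-L3-t3's (E1)/(E2), p472109) and COMPACT `Π^temp_{X_K}`, the LITERAL one-call FIRES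
  from `hTF · hab · hadm` alone FOR EVERY frame family `(PA, α, hαo, hαN)`: all other inputs are inhabited exactly as in
  `prop24_cor25_ofPiData_byName_of_oneVertexFibres` (abc-iut-L5-t11 gen 10, p479269), and `hI_j^lit` by
  `arithStatementI_oneVertexDecompositionData (α j)`;
* `sec2_oneCall_frame_nonvacuous` — **the HEADLINE, binder-free**: for every prime `p` there EXIST `X d S T`, an origin
  record `P : PiData`, a cusp and a prime set `Σ ∌ p` such that (1) the frame LAW `hI^frame` is INHABITED — some per-level
  decomposition data `Dd_j` on `Π^tp_j` satisfy `ArithMaximalCompactStatementI (Dd j) πA_j` at the CANONICAL [SemiAnbd]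
  Prop 5.2 (iv) frame `πA_j : Π^tp_j ↠ Π^tp_j ⧸ N̄_j` (a quotient map: open; kills `N_j`; `Ker πA_j = π₁^temp(𝒢_j)` exactly)
  — AND (2) the CONCLUSION of the one-call ([IUTchI] Prop. 2.4 (i)(ii)(iii) ∧ Cor. 2.5 AS TYPED at `ofSpecialFibre X d S …`)
  HOLDS, (2) obtained by CALLING the literal one-call AT THE CANONICAL FRAME (so with NO frame binder left — this is how
  the frame one-call `prop24_cor25_ofPiData_byName_noRF_frame` of part (F) fires) at abc-iut-f-193's cusped free-profinite
  witness (`exists_piData_cusp_torsionFreeAb_ab_adm_exposed`, p478892).  This is the §2 NV-column entry for the literal /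
  frame one-call (the v0.18 entry `sec2_oneCall_nonvacuous` is for the canonical-augmentation one-call of p467772; at
  one-vertex fibres the frame firing has literally the conclusion of `prop24_cor25_ofPiData_byName_of_oneVertexFibres`,
  p479269, so it is not restated as a separate theorem).

GLOBAL TAG: «[degenerate; single-vertex levels; ⊤ verticial; COMPACT Π^temp (the model's tempered group is profinite);
(D3)]» — inhabited ≠ discharged.  HONEST TAGS PER HYPOTHESIS: exactly those of p479269's module docstring (one-vertex
fibres, no nodes, `Π^temp = G_{ℚ_p} × F̂₂` compact `= Π̂`, `admKer = 1`; `hTF` GENUINE-SHAPE, `hab`/`hadm`/`hNN_i`/`hA3ar_j`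
DEGENERATE), plus: `hI_j^lit` / `hI_j^frame` — DEGENERATE (one-vertex `Dd_j`, EVERY frame); the frame data `α_j := πA_j`,
`hαo`, `hαN` — GENUINE-SHAPE (the canonical Prop 5.2 (iv) frame exists at EVERY genuine datum, part (F)).  abc-iut-L3-t2's
HONEST LIMITS carried (not the tower of a curve, not André's `π₁^temp`).  A model inhabits OUR binders only — it says the
literal / frame one-call's hypotheses are JOINTLY SATISFIABLE and that the call elaborates at a datum, nothing about the
curves of [IUTchI] §2.  Nothing here bears on [IUTchIII] Cor. 3.12; typed ≠ inhabited ≠ discharged; nothing here asserts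
that abc is proved or refuted.
-/

noncomputable section

namespace Literature.IUT.HodgeTheaters

open _root_.Topology
open scoped Pointwise
open Literature.AnabelianGeometry.SemiGraphs Literature.AnabelianGeometry.SemiGraphs.ProfiniteSemiGraph

/-! ### A. Group-theoretic bookkeeping: the one-vertex decomposition data -/

/-- A conjugate of `⊤` is `⊤`. [cite: MochizukiSemiAnbd2006, §0 p.5] -/
private theorem conjSubgroup_top_eq_top {G : Type*} [Group G] (g : G) : conjSubgroup g (⊤ : Subgroup G) = ⊤ := by
  rw [conjSubgroup, ← MonoidHom.range_eq_map]
  exact MonoidHom.range_eq_top.mpr (MulAut.conj g).surjective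

/-- **[SemiAnbd] Thm 5.4 (i)'s conclusion-shape at the ONE-VERTEX decomposition data, for EVERY augmentation**
(DEGENERATE bookkeeping): with a single vertex whose decomposition group is `⊤` and no branch, every (compact, ample)
subgroup lies in the verticial subgroup `⊤`, and the two-verticial clause is VACUOUS because the only verticial subgroup
is `⊤` (`conjSubgroup g ⊤ = ⊤`).  Nothing of Thm 5.4 is proved. [cite: MochizukiSemiAnbd2006, Thm 5.4 (i), p. 66] -/
theorem arithStatementI_oneVertexDecompositionData {Gtp : Type*} [Group Gtp] [TopologicalSpace Gtp]
    {PA : Type*} [Group PA] [TopologicalSpace PA] (α : Gtp →* PA) :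
    ArithMaximalCompactStatementI
      ({ E := Empty, edgeOf := fun b => b.elim, abut := fun b => b.elim, vertGp := fun _ => ⊤,
         brGp := fun b => b.elim, brGp_le_vertGp := fun b => b.elim } : DecompositionData Gtp Unit Empty) α := by
  intro K _ _
  have hvertD : ∀ W : Subgroup Gtp,
      IsVerticial ({ E := Empty, edgeOf := fun b => b.elim, abut := fun b => b.elim, vertGp := fun _ => ⊤,
                     brGp := fun b => b.elim, brGp_le_vertGp := fun b => b.elim } : DecompositionData Gtp Unit Empty) W →
        W = ⊤ := by
    rintro W ⟨_, g, rfl⟩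
    exact conjSubgroup_top_eq_top g
  refine ⟨⟨⊤, ⟨(), 1, (conjSubgroup_top_eq_top _).symm⟩, le_top⟩, ?_⟩
  intro W₁ W₂ hW₁ hW₂ hne12
  exact absurd ((hvertD W₁ hW₁).trans (hvertD W₂ hW₂).symm) hne12

namespace StableCurveTemperedData

namespace OfSpecialFibre

variable {p : ℕ} [Fact p.Prime] (X : TemperedCurve p)
  (T : SpecialFibreTower X.DeltaTemp) (Sigma SigmaHat : Set ℕ) (hsub : Sigma ⊆ SigmaHat)
  (hne : Set.Nonempty Sigma) (hprime : ∀ q ∈ SigmaHat, q.Prime)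
  (d : X.GroupLevelData) (S : SpecialFibreData (X.toTemperedArithmeticGroup d))
  (h36 : S.Gc.Prop36Hypotheses) (hp : p ∉ Sigma) (TpH : Subgroup S.chart.G)
  (HatH : Subgroup (TemperedGraphGroupData.exists_completion_of_prop36 S.Gc h36 S.chart).choose)
  (hle : TpH.map (TemperedGraphGroupData.exists_completion_of_prop36 S.Gc h36
    S.chart).choose_spec.choose.toMonoidHom ≤ HatH)
  (cuspMeetsH : {x : X.Pt // X.IsCusp x} → Prop)

/-! ### B. The LITERAL one-call FIRES at a datum with one-vertex fibres and compact `Π^temp_{X_K}`, for every frame -/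

/-- **[IUTchI] Prop. 2.4 (i)(ii)(iii) ∧ Cor. 2.5 AS TYPED at a 𝔛-datum whose tower has ONE-VERTEX fibres with `⊤`
verticial and COMPACT `Π^temp_{X_K}`, from `hTF · hab · hadm` ALONE, by CALLING the LITERAL one-call
`prop24_cor25_ofPiData_byName_noRF_literal` (p485729) FOR EVERY frame family `(PA, α, hαo, hαN)`** — the remaining inputs
inhabited DEGENERATELY exactly as in `prop24_cor25_ofPiData_byName_of_oneVertexFibres` (p479269): `G_i` the one-vertex
`PSCDatum` on `Π̂_{𝔾_{J_i}}` (`Π_v := ι(⊤) = ⊤`), `σ_i` from `Unique`, `Λv := ⊤`, `hNN_i` / `hA3ar_j` by their first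
disjuncts (`ι(⊤) = ⊤` by compactness), empty node data, `Dd_j` one-vertex with `Π^temp_{𝔊,v} := ⊤` so that `hI_j^lit`
holds for EVERY `α_j` (`arithStatementI_oneVertexDecompositionData`).  Degenerate: documents that the literal one-call's
(A3)/(ii)-side inputs and its frame binders impose nothing at such data.
([IUTchI] Prop 2.4, Cor 2.5 pp.50-51; [SemiAnbd] Thm 5.4 (i) p.66) [claim: Mochizuki2012, status: disputed] -/
theorem prop24_cor25_ofPiData_byName_literal_of_oneVertexFibres (P : SpecialFibreTower.PiData X d S T)
    (x : {x : X.Pt // X.IsCusp x}) [CompactSpace X.PiTemp]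
    (hUV : ∀ i, Nonempty (Unique (T.Gc i).graph.Vertex))
    (htop : ∀ i v, (⊤ : Subgroup (T.chart i).G) ∈ verticialSubgroups (T.chart i) v)
    (hTF : ∀ H : Subgroup X.DeltaHat, IsOpen (H : Set X.DeltaHat) →
      ∀ (h : H) (n : ℕ), n ≠ 0 →
        SigmaCharDetects Set.univ H h → SigmaCharDetects Set.univ H (h ^ n))
    (hab : ∀ (i : ℕ) (A : Type) [CommGroup A] [Finite A] (χ : T.N i →* A),
      IsOpen ((χ.ker : Subgroup (T.N i)) : Set (T.N i)) →
      (∀ q : ℕ, q.Prime → q ∣ Nat.card A → q ∈ Sigma) → (T.adm i).toMonoidHom.ker ≤ χ.ker)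
    (hadm : ∀ U ∈ 𝓝 (1 : ↥X.DeltaTemp), ∃ j, ((T.admKer j : Subgroup ↥X.DeltaTemp) : Set ↥X.DeltaTemp) ⊆ U)
    -- the frame family of the literal one-call: ANY open `α_j` out of `Π^tp_j` killing `N_j`
    {PA : ℕ → Type*} [∀ j, Group (PA j)] [∀ j, TopologicalSpace (PA j)]
    (α : ∀ j, ((qTowerOfSpecialFibreTower X T d S h36 Sigma SigmaHat hsub hne hprime hp TpH HatH hle cuspMeetsH P.admKer_normal_pi).Q j).Tp →* PA j)
    (hαo : ∀ j, IsOpenMap (α j))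
    (hαN : ∀ (j : ℕ) (n : X.DeltaTemp), n ∈ T.N j → α j ((qTowerOfSpecialFibreTower X T d S h36 Sigma SigmaHat hsub hne hprime hp TpH HatH hle cuspMeetsH P.admKer_normal_pi).qtp j (n : X.PiTemp)) = 1) :
    ((ofSpecialFibre X d S h36 Sigma SigmaHat hsub hne hprime hp TpH HatH hle cuspMeetsH).Prop24i ∧
      (ofSpecialFibre X d S h36 Sigma SigmaHat hsub hne hprime hp TpH HatH hle cuspMeetsH).Prop24ii ∧
      (ofSpecialFibre X d S h36 Sigma SigmaHat hsub hne hprime hp TpH HatH hle cuspMeetsH).Prop24iii) ∧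
    ((ofSpecialFibre X d S h36 Sigma SigmaHat hsub hne hprime hp TpH HatH hle cuspMeetsH).Cor25Decomposition ∧
      (ofSpecialFibre X d S h36 Sigma SigmaHat hsub hne hprime hp TpH HatH hle cuspMeetsH).Cor25Inertia) := by
  classical
  -- `ι(⊤) = ⊤` for the level graphs and the level quotients (compactness; p479269)
  have hrange : ∀ i, (⊤ : Subgroup (T.chart i).G).map (levelGraph X T Sigma SigmaHat hsub hne hprime i).ι = ⊤ :=
    levelGraph_map_top_eq_top X T Sigma SigmaHat hsub hne hprime
  have hQrange := qTower_map_top_eq_top X T Sigma SigmaHat hsub hne hprime d S h36 hp TpH HatH hle cuspMeetsH P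
  -- (i)-side: the one-vertex PSC datum on `Π̂_{𝔾_{J_i}}`, `Π_v := ι(⊤)`
  let G : ∀ i, PSCDatum (levelGraph X T Sigma SigmaHat hsub hne hprime i).Hat := fun i =>
    { Sigma := {q | q.Prime}
      sigma_prime := fun _ hq => hq
      sigma_nonempty := ⟨2, Nat.prime_two⟩
      graph := { V := PUnit, N := PEmpty, C := PEmpty, nodeEnds := fun e => e.elim, cuspEnd := fun c => c.elim }
      vertGp := fun _ => (⊤ : Subgroup (T.chart i).G).map (levelGraph X T Sigma SigmaHat hsub hne hprime i).ι
      nodeGp := fun e => e.elim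
      cuspGp := fun c => c.elim
      genus := fun _ => 0
      isClosed_vertGp := fun _ => by
        rw [hrange i, Subgroup.coe_top]; exact isClosed_univ
      isClosed_nodeGp := fun e => e.elim
      isClosed_cuspGp := fun c => c.elim
      nodeGp_le := fun e => e.elim
      cuspGp_le := fun c => c.elim
      proSigma := ⟨fun _ _ _ hq _ => hq⟩ }
  -- (A3) := F-2540 by its first disjunct
  have hNN : ∀ i, (G i).VerticialIntersectionNear := by
    intro i ε v w g h _
    refine Or.inl ⟨Subsingleton.elim _ _, ?_⟩
    change g⁻¹ * h ∈ (⊤ : Subgroup (T.chart i).G).map (levelGraph X T Sigma SigmaHat hsub hne hprime i).ι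
    rw [hrange i]; exact Subgroup.mem_top _
  -- identification data
  let σ : ∀ i, (T.Gc i).graph.Vertex ≃ (G i).graph.V := fun i => @Equiv.equivPUnit _ (hUV i).some
  let Λv : ∀ i, (G i).graph.V → Subgroup (T.chart i).G := fun _ _ => ⊤
  have hvert : ∀ i (v : (T.Gc i).graph.Vertex), Λv i (σ i v) ∈ verticialSubgroups (T.chart i) v :=
    fun i v => htop i v
  have hΛv : ∀ i v, (Λv i v).map (levelGraph X T Sigma SigmaHat hsub hne hprime i).ι = (G i).vertGp v :=
    fun _ _ => rfl
  -- (ii)-side: one-vertex decomposition data on `Π^tp_X/admKer_j`, `Π^temp_{𝔊,v} := ⊤`; `hI_j^lit` for EVERY frame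
  let Dd : ∀ j, DecompositionData ((qTowerOfSpecialFibreTower X T d S h36 Sigma SigmaHat hsub hne hprime hp TpH
      HatH hle cuspMeetsH P.admKer_normal_pi).Q j).Tp Unit Empty := fun _ =>
    { E := Empty
      edgeOf := fun b => b.elim
      abut := fun b => b.elim
      vertGp := fun _ => ⊤
      brGp := fun b => b.elim
      brGp_le_vertGp := fun b => b.elim }
  have hI : ∀ j, ArithMaximalCompactStatementI (Dd j) (α j) := fun j =>
    arithStatementI_oneVertexDecompositionData (α j)
  -- `hA3ar_j` by its first disjunct (`ι_j(⊤) = ⊤`)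
  refine prop24_cor25_ofPiData_byName_noRF_literal X d T Sigma SigmaHat hsub hne hprime S h36 hp TpH HatH hle
    cuspMeetsH P x hTF G hNN σ Λv hvert hΛv (fun i e => e.elim) (fun i e => e.elim) (fun i e => e.elim)
    (fun i e => e.elim) (fun i e => e.elim) (fun i e => e.elim) (fun i e => e.elim) (fun i e => e.elim) hab hadm Dd
    α hαo hαN hI (EA := fun _ => Empty) (fun j e => e.elim) (fun j e => e.elim) (fun j e => e.elim)
    (fun j e => e.elim) ?_
  intro j Λ _ _ _ v w g h γ _ _
  refine Or.inl ⟨Subsingleton.elim _ _, ?_⟩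
  change g⁻¹ * h ∈ (⊤ : Subgroup _).map _
  rw [hQrange j]; exact Subgroup.mem_top _

/-! ### C. The headline: the frame law is inhabited and the literal / frame one-call fires, at one datum for every `p` -/

/-- **THE LITERAL / FRAME §2 ONE-CALL IS JOINTLY NON-VACUOUS (binder-free headline).**  For every prime `p` there exist a
`TemperedCurve p` datum `X` with parameter bundle `d`, special-fibre data `S`, a special-fibre tower `T` with an origin
record `P : PiData X d S T`, a CUSP of `X_K`, and a nonempty prime set `Σ ∌ p` (`Σ̂ := Σ`, `ℍ := ⊤`) such that
(1) the frame LAW `hI^frame` is INHABITED: some per-level decomposition data `Dd_j` on `Π^tp_j = Π^temp_{X_K} ⧸ admKer_j`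
satisfy [SemiAnbd] Thm 5.4 (i)'s conclusion-shape `ArithMaximalCompactStatementI (Dd j) πA_j` at the CANONICAL
Prop 5.2 (iv) frame `πA_j : Π^tp_j ↠ Π^tp_j ⧸ (N_j ⧸ admKer_j)`; AND (2) the CONCLUSION of the one-call — [IUTchI]
Prop. 2.4 (i)(ii)(iii) ∧ Cor. 2.5 AS TYPED at the genuine-shape 𝔛-datum `ofSpecialFibre X d S …` — HOLDS, obtained by
CALLING the literal one-call at the canonical frame (`prop24_cor25_ofPiData_byName_literal_of_oneVertexFibres` with
`α_j := πA_j`, open as a quotient map and killing `N_j` by construction, at abc-iut-f-193's cusped free-profinite witness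
with exposed fibres, `exists_piData_cusp_torsionFreeAb_ab_adm_exposed`).
DEGENERATE WITNESS (module docstring): one-vertex fibres, no nodes, `Π^temp = G_{ℚ_p} × F̂₂` compact (`= Π̂`), `admKer = 1`,
`Dd_j` one-vertex; `hTF` and the frame genuine-shape; a model inhabits OUR binders only.
([IUTchI] Prop 2.4, Cor 2.5 pp.50-51; [SemiAnbd] Thm 5.4 (i) p.66) [claim: Mochizuki2012, status: disputed] -/
theorem sec2_oneCall_frame_nonvacuous (p : ℕ) [Fact p.Prime] :
    ∃ (X : TemperedCurve p) (d : X.GroupLevelData) (S : SpecialFibreData (X.toTemperedArithmeticGroup d))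
      (T : SpecialFibreTower X.DeltaTemp) (P : SpecialFibreTower.PiData X d S T) (_ : {x : X.Pt // X.IsCusp x})
      (Sigma : Set ℕ) (hne : Sigma.Nonempty) (hprime : ∀ q ∈ Sigma, q.Prime) (hp : p ∉ Sigma),
      (∃ Dd : ∀ j, DecompositionData ((qTowerOfSpecialFibreTower X T d S S.hyp.toProp36Hypotheses Sigma Sigma
          Set.Subset.rfl hne hprime hp ⊤ ⊤ le_top (fun _ => True) P.admKer_normal_pi).Q j).Tp Unit Empty,
        ∀ j,
          haveI := qTower_map_N_normal X d T Sigma Sigma Set.Subset.rfl hne hprime S S.hyp.toProp36Hypotheses hp ⊤ ⊤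
            le_top (fun _ => True) P j;
          ArithMaximalCompactStatementI (Dd j)
            (QuotientGroup.mk' (((T.N j).map X.DeltaTemp.subtype).map
              ((qTowerOfSpecialFibreTower X T d S S.hyp.toProp36Hypotheses Sigma Sigma Set.Subset.rfl hne hprime hp ⊤ ⊤
                le_top (fun _ => True) P.admKer_normal_pi).qtp j)))) ∧
      (((ofSpecialFibre X d S S.hyp.toProp36Hypotheses Sigma Sigma Set.Subset.rfl hne hprime hp ⊤ ⊤ le_top
            (fun _ => True)).Prop24i ∧
        (ofSpecialFibre X d S S.hyp.toProp36Hypotheses Sigma Sigma Set.Subset.rfl hne hprime hp ⊤ ⊤ le_top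
            (fun _ => True)).Prop24ii ∧
        (ofSpecialFibre X d S S.hyp.toProp36Hypotheses Sigma Sigma Set.Subset.rfl hne hprime hp ⊤ ⊤ le_top
            (fun _ => True)).Prop24iii) ∧
      ((ofSpecialFibre X d S S.hyp.toProp36Hypotheses Sigma Sigma Set.Subset.rfl hne hprime hp ⊤ ⊤ le_top
            (fun _ => True)).Cor25Decomposition ∧
        (ofSpecialFibre X d S S.hyp.toProp36Hypotheses Sigma Sigma Set.Subset.rfl hne hprime hp ⊤ ⊤ le_top
            (fun _ => True)).Cor25Inertia)) := by
  -- (`have` + `rcases`, not `obtain … := term`: generalising the term over this goal is expensive)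
  have hw := exists_piData_cusp_torsionFreeAb_ab_adm_exposed p
  rcases hw with ⟨X, d, S, T, ⟨P⟩, -, -, ⟨x⟩, -, hTF, hab, hadm, hcpt, hUV, -, -, htop, -⟩
  haveI := hcpt
  -- a prime `q ≠ p`: `Σ := {q}`
  let q : ℕ := if p = 2 then 3 else 2
  have hq : q.Prime := by
    by_cases h : p = 2
    · simp only [q, h, if_true]; exact Nat.prime_three
    · simp only [q, h, if_false]; exact Nat.prime_two
  have hpq : p ≠ q := by
    by_cases h : p = 2
    · simp only [q, h, if_true]; decide
    · simp only [q, h, if_false]; exact h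
  have hprime : ∀ r ∈ ({q} : Set ℕ), r.Prime := fun r hr => by rw [Set.mem_singleton_iff.mp hr]; exact hq
  have hp : p ∉ ({q} : Set ℕ) := fun h => hpq (Set.mem_singleton_iff.mp h)
  -- the canonical Prop 5.2 (iv) frame at the witness: `N̄_j ⊴ Π^tp_j` (part (F))
  haveI hN := fun j => qTower_map_N_normal X d T {q} {q} Set.Subset.rfl (Set.singleton_nonempty q) hprime S
    S.hyp.toProp36Hypotheses hp ⊤ ⊤ le_top (fun _ => True) P j
  refine ⟨X, d, S, T, P, x, {q}, Set.singleton_nonempty q, hprime, hp, ?_, ?_⟩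
  · -- (1) the frame law at the one-vertex decomposition data (every verticial subgroup is `⊤`)
    refine ⟨fun _ =>
      { E := Empty
        edgeOf := fun b => b.elim
        abut := fun b => b.elim
        vertGp := fun _ => ⊤
        brGp := fun b => b.elim
        brGp_le_vertGp := fun b => b.elim }, fun j => ?_⟩
    exact arithStatementI_oneVertexDecompositionData _
  · -- (2) the LITERAL one-call CALLED at the canonical frame `πA_j : Π^tp_j ↠ Π^tp_j ⧸ N̄_j` (open; kills `N_j`; part (F))
    exact prop24_cor25_ofPiData_byName_literal_of_oneVertexFibres X T {q} {q} Set.Subset.rfl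
      (Set.singleton_nonempty q) hprime d S S.hyp.toProp36Hypotheses hp ⊤ ⊤ le_top (fun _ => True) P x hUV htop hTF
      (hab {q}) hadm
      (PA := fun j => ((qTowerOfSpecialFibreTower X T d S S.hyp.toProp36Hypotheses {q} {q} Set.Subset.rfl
          (Set.singleton_nonempty q) hprime hp ⊤ ⊤ le_top (fun _ => True) P.admKer_normal_pi).Q j).Tp ⧸
        ((T.N j).map X.DeltaTemp.subtype).map ((qTowerOfSpecialFibreTower X T d S S.hyp.toProp36Hypotheses {q} {q}
          Set.Subset.rfl (Set.singleton_nonempty q) hprime hp ⊤ ⊤ le_top (fun _ => True) P.admKer_normal_pi).qtp j))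
      (fun j => QuotientGroup.mk' _)
      (fun j => isOpenMap_frame X d T {q} {q} Set.Subset.rfl (Set.singleton_nonempty q) hprime S
        S.hyp.toProp36Hypotheses hp ⊤ ⊤ le_top (fun _ => True) P j)
      (fun j n hn => frame_apply_eq_one X d T {q} {q} Set.Subset.rfl (Set.singleton_nonempty q) hprime S
        S.hyp.toProp36Hypotheses hp ⊤ ⊤ le_top (fun _ => True) P j n hn)

end OfSpecialFibre

end StableCurveTemperedData

end Literature.IUT.HodgeTheaters

end
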